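import Mathlib.GroupTheory.Index
import Mathlib.LinearAlgebra.FiniteDimensional.Basic

/-!
# T5KFiniteCommensurable — `K`-finiteness is preserved by translation when `K` is commensurable
with its conjugate

Kernel form of one sentence of route/T5-N4-p5.md v12 (A3) STEP 6 (cell pub-hodge-repro2, seat p5):
«K-finiteness is preserved … by G(𝔸_f) (K_f^{max} is commensurable with its conjugates)».

Setting: a representation `ρ : G →* (V →ₗ[k] V)` of a group `G` on a `k`-vector space `V`, a
subgroup `K`, an element `g`, and a subgroup `H` contained in `g K g⁻¹` (i.e. `g⁻¹ h g ∈ K` for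
`h ∈ H`) with `H ∩ K` of FINITE INDEX in `K` (`(H.subgroupOf K).FiniteIndex`).  If the `K`-orbit of `v` spans a finite-dimensional subspace, so
does the `K`-orbit of `ρ g v`: with `T` a set of representatives of `K / H`, every `κ g`, `κ ∈ K`,
is `t g κ′` with `t ∈ T`, `κ′ ∈ K`, so `span (K · ρ g v) ⊆ Σ_{t ∈ T} ρ(t g) (span (K · v))`.
The orbit span is written out as `Submodule.span k (Set.range fun κ : K => ρ κ v)` (p8's
`orbitSpan`, not re-declared here); the finite-index hypothesis is supplied, for a compact open `K`
of a topological group, by p8's `finiteIndex_stabilizer_coset` / `finite_orbit_coset_of_isOpen_of_isCompact`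
(the stabiliser of `g K` in `K` is `K ∩ g K g⁻¹`), not restated here.  Nothing about `G(𝔸_f)`,
`K_f^{max}` or `π₀` is asserted.
-/

namespace Summit.Ventures.HodgeRepro2.T5KFiniteCommensurable

variable {k G V : Type*} [Field k] [Group G] [AddCommGroup V] [Module k V]

/-- The translation identity: for `κ ∈ K` write `t := (κ H)ᵒᵘᵗ` (the chosen representative of the
coset of `κ` modulo `H ∩ K`), so that `κ = t h` with `h ∈ H ∩ K`; if `g⁻¹ h⁻¹ g ∈ K` then
`κ g = t g κ′` with `κ′ := g⁻¹ h⁻¹ g ∈ K`. -/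
theorem exists_mul_eq_out_mul (K H : Subgroup G) (g : G)
    (hHg : ∀ h ∈ H, g⁻¹ * h * g ∈ K) (κ : K) :
    ∃ κ' ∈ K, (κ : G) * g =
      (((QuotientGroup.mk κ : K ⧸ H.subgroupOf K).out : K) : G) * g * κ' := by
  obtain ⟨h, hh⟩ := QuotientGroup.mk_out_eq_mul (H.subgroupOf K) κ
  have hhH : ((h : K) : G) ∈ H := Subgroup.mem_subgroupOf.mp h.2
  refine ⟨g⁻¹ * ((h : K) : G)⁻¹ * g, hHg _ (H.inv_mem hhH), ?_⟩
  rw [hh]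
  push_cast
  simp only [mul_assoc, mul_inv_cancel_left]

/-- The orbit span of `ρ g v` lies in the finite sum of the translates `ρ (t g)` of the orbit
span of `v`, `t` running over representatives of `K / (H ∩ K)`. -/
theorem span_orbit_apply_le (ρ : G →* (V →ₗ[k] V)) (K H : Subgroup G) (g : G)
    (hHg : ∀ h ∈ H, g⁻¹ * h * g ∈ K) (v : V) :
    Submodule.span k (Set.range fun κ : K => ρ κ (ρ g v)) ≤
      ⨆ q : K ⧸ H.subgroupOf K,
        (Submodule.span k (Set.range fun κ : K => ρ κ v)).map (ρ (((q.out : K) : G) * g)) := by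
  rw [Submodule.span_le]
  rintro _ ⟨κ, rfl⟩
  obtain ⟨κ', hκ', hκ⟩ := exists_mul_eq_out_mul K H g hHg κ
  have hval : ρ κ (ρ g v) =
      ρ ((((QuotientGroup.mk κ : K ⧸ H.subgroupOf K).out : K) : G) * g) (ρ κ' v) := by
    rw [← Module.End.mul_apply, ← map_mul, hκ, map_mul, Module.End.mul_apply]
  simp only [SetLike.mem_coe]
  rw [hval]
  refine Submodule.mem_iSup_of_mem (QuotientGroup.mk κ) ?_
  exact Submodule.mem_map_of_mem (Submodule.subset_span ⟨⟨κ', hκ'⟩, rfl⟩)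

/-- (A3) STEP 6: if `H ≤ g K g⁻¹` with `H ∩ K` of finite index in `K` and the `K`-orbit of `v` spans a
finite-dimensional subspace, then so does the `K`-orbit of `ρ g v` — «K-finiteness is preserved by
G(𝔸_f) (K_f^{max} is commensurable with its conjugates)». -/
theorem finiteDimensional_span_orbit_apply (ρ : G →* (V →ₗ[k] V)) (K H : Subgroup G)
    (g : G) (hHg : ∀ h ∈ H, g⁻¹ * h * g ∈ K) [(H.subgroupOf K).FiniteIndex] (v : V)
    [FiniteDimensional k (Submodule.span k (Set.range fun κ : K => ρ κ v))] :
    FiniteDimensional k (Submodule.span k (Set.range fun κ : K => ρ κ (ρ g v))) :=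
  Submodule.finiteDimensional_of_le (span_orbit_apply_le ρ K H g hHg v)

/-- The same with `H := K ⊓ g K g⁻¹` itself, the conjugate written as
`{x ∣ g⁻¹ x g ∈ K}` (a subgroup, `Subgroup.comap` of conjugation by `g⁻¹`). -/
theorem finiteDimensional_span_orbit_apply_of_inf (ρ : G →* (V →ₗ[k] V)) (K : Subgroup G) (g : G)
    [((K ⊓ K.comap (MulAut.conj g⁻¹).toMonoidHom).subgroupOf K).FiniteIndex] (v : V)
    [FiniteDimensional k (Submodule.span k (Set.range fun κ : K => ρ κ v))] :
    FiniteDimensional k (Submodule.span k (Set.range fun κ : K => ρ κ (ρ g v))) := by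
  refine finiteDimensional_span_orbit_apply ρ K (K ⊓ K.comap (MulAut.conj g⁻¹).toMonoidHom)
    g ?_ v
  intro h hh
  have h2 : (MulAut.conj g⁻¹).toMonoidHom h ∈ K := Subgroup.mem_comap.mp hh.2
  simpa [MulAut.conj_apply] using h2

end Summit.Ventures.HodgeRepro2.T5KFiniteCommensurable
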